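import Literature.NumberTheory.EllipticCurves.DeShalit1987.KatzPAdicLFunctionFunctionalEquation
import Literature.NumberTheory.EllipticCurves.KellerYin2024.AnomalousLambdaInvariants
import Literature.NumberTheory.EllipticCurves.Rubin1991.TwoVariableCMLines
import HarnessLib

/-!
# Hida, Ann. of Math. 172 (2010), Theorem I (anticyclotomic `μ = 0`) — typed a SECOND time, on the
# de Shalit frame `IsKatzBranch` of the REFLECTED twist `θ_K·‖·‖ = reflect θ_K⁻¹` along the
# anticyclotomic `ℤ_p`-extension (receptacle `𝒪_{ℂ_p}⟦T⟧`, currency `HasUnitContent`), with the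
# proved plumbing by which the cell `bsd-eis` consumes it

Cell `bsd-eis` (FULL-BSD rank ≤ 1 programme D-0033; HOME `run/shared/lean/pub/bsd-eis/`), seat
`bsd-eis-k5-ty` gen 7 (typer), executing option O1 of `HOME/k5-ty-g6/BETA-SPEC.md` §3 (row A1, crux 2
`GoodLatticeBDPValue` = stmt-BirchSwinnertonDyer-19032, line `halves`, stub `stub_muLambda`, residue
[BR𝟙]/[BRω]: the two-variable (Rubin) road, step (R5′) "`g(S=0) mod p ≠ 0`"). STATEMENTS FIRST
(D-0064): ONE named PUBLISHED fact (`thmI_mu_katzBranch_reflect_eq_zero`, +1 declared debt) and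
proved API; no `sorry`, no `instance`, no notation, no new notion (every ingredient —
`DeShalit1987.IsKatzBranch`, `DeShalit1987.reflect`, `GreenbergVatsal2000.HasUnitContent`,
`KellerYin2024.IsHeckeCharOf`, `ZpExtension.IsAnticyclotomic` — is the tree's).

## Why a second typing of the same printed theorem

The sibling `AnticyclotomicKatzMuInvariant.lean` (`Hida2010MuInvariant.thmI_mu_katzLFunction_eq_zero`,
p432386) states Hida's Theorem I for EVERY witness `L ∈ R₀⟦T⟧` of the CGLS frame
`CastellaGrossiLeeSkinner2022.IsKatzLFunction ι' v v̄ Cbar κ γ θ_K Ω_K Ω_p L` (receptacle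
`UnrSeries p = R₀⟦T⟧`, conclusion `∃ n, FirstUnitCoeffAt L n`). The two-variable (Rubin) road of the
cell never produces such a witness: Rubin 1991 Thm. 4.1 (i) (`Rubin1991.thm41_…`) delivers the
two-variable Katz–de Shalit frame `IsKatzMeasure₂ … κ κ' γ⁻¹ γ'⁻¹ θ_K⁻¹ Ω δ Ω_p G` of `θ_K⁻¹` at the
INVERSE generators, and de Shalit's `p`-adic functional equation
(`DeShalit1987.thmII64_katzMeasure₂_functionalEquation.anticyclotomicLine_left`, II §6.4) turns its
anticyclotomic slice `G.map constantCoeff ∈ 𝒪_{ℂ_p}⟦T⟧` — pointwise, up to the unit `C·r(g)` — into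
a witness `G₁ = Ǧ.map constantCoeff` of the ONE-variable de Shalit frame
`DeShalit1987.IsKatzBranch ι' v v̄ S κ γ⁻¹ (reflect θ_K⁻¹) Ω δ Ω_p G₁` (`reflect θ_K⁻¹ = θ_K·‖·‖`,
`DeShalit1987.reflect_inv_of_galConj_eq`). A series-level comparison between an INDEPENDENTLY
witnessed `G₁ ∈ 𝒪_{ℂ_p}⟦T⟧` and `L ∈ R₀⟦T⟧` would need Strassmann's theorem on closed sub-discs, the
non-vanishing of infinitely many `L(θ_Kφ, 1)` and a boundedness criterion for `(1+T)^α` — none in the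
tree (BETA-SPEC §2) — and the two receptacles differ. Hence the printed theorem is transcribed here
directly on the de Shalit frame, with the PRIMARY conclusion "`G₁ mod 𝔪_{𝒪_{ℂ_p}} ≠ 0`"
(`G₁.map (IsLocalRing.residue 𝒪_{ℂ_p}) ≠ 0`, planner RULING L26) and the proved iff-forms
`HasUnitContent G₁` ("some coefficient of `G₁` is a unit of `𝒪_{ℂ_p}`", the tree's generator-level
`μ = 0` token, `hasUnitContent_iff_map_residue_padicComplexInt_ne_zero`) and `∃ n, ‖[Tⁿ]G₁‖ = 1`
(`hasUnitContent_iff_exists_norm_coeff_eq_one`). RELATION BETWEEN THE TWO TYPED FORMS OF THEOREM I: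
the same printed theorem read on two frames of the same object; NEITHER typed form derives the other
in the tree (that derivation is exactly the untyped cross-frame comparison of BETA-SPEC §2), and
neither is a special case of the other. The published input is THE SAME (Hida 2010 Thm. I as used by
CGLS for `𝓛_θ`); the +1 is a second currency of one theorem, not a new input.

## Why the reflected de Shalit line IS the line of CGLS's `𝓛_θ` (BETA-SPEC §1, term by term; all
## objects are the tree's typed frames, so this is a comparison of two DEFINITIONS plus Katz (5.3.5))

CGLS define `𝓛_θ` as the image of the Katz measure under `π_θ : g ↦ θ(g)[g]_Γ` (arXiv:2008.02571v2
TeX L1031–1040: "The element `𝓛_θ` is then obtained by applying `π_θ` to the Katz `p`-adic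
`L`-function described in [Kriz16], setting `χ⁻¹ = θ_K ξ 𝐍_K`") — the `θ_K`-branch of the measure
pushed to the anticyclotomic `Γ`, i.e. Hida's `φ⁻_{θ_K}` (`θ_K = θ ∘ Nm` has order prime to `p`, hence
is a branch character; p432386's module docstring) — and characterise it (Thm. 2.1.2) by the values at
`ξ` of infinity type `(n, -n)`, typed in `IsKatzLFunction` through `ξ = φ^c`, `φ` of tree type
`(n, -n)` everywhere unramified with avatar `r` through `κ`, point `T = r(γ) - 1`, value
`ι'⁻¹(4 Γ(n+1) ((2πi)/D_K^{1/2})^{n-1} (1 - θ(p)⁻¹φ(v̄)⁻¹)(1 - θ(p)φ(v)p⁻¹) L(θ_Kφ, 1) / Ω_K^{2n}) Ω_p^{2n}`.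
The de Shalit frame of the twist `λ = θ_K‖·‖` (II.4.16 (49)–(50), `DeShalit1987/KatzPAdicLFunction.lean`
(T1)–(T9)) prescribes, at `ε = λρ` with `ρ` through `κ` of tree type `(-n, n)` — so `ε` of type
`(-(n+1), n-1)`, `m = n+1`, `j = n-1`, inside `0 ≤ j < m` (`DeShalit1987.hasInfinityType_reflect_inv_mul`)
— at the point `T = r_ρ(γ_dS) - 1`, the value
`ι'⁻¹((Ω^{2n})⁻¹ (2π/δ)^{n-1} (1 - ε(v)⁻¹p⁻¹) Γ(n+1) ∏_{w ∈ S ∪ {v̄}}(1 - ε(w)) L(ε, 0)) Ω_p^{2n}`.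
Dictionary: `ρ := φ^c` (`= φ⁻¹` for the everywhere-unramified anticyclotomic `φ` of the CGLS frame,
BETA-SPEC §1; type `(-n, n)`; its avatar is `r⁻¹` since `κ` is anticyclotomic, so the points agree iff
`γ_dS = γ⁻¹` — exactly the inverse generator the functional equation hands over);
`ε(v) = θ_K(v)ρ(v)·Nv⁻¹ = θ(p)φ(v̄)p⁻¹`, so `(1 - ε(v)⁻¹p⁻¹) = (1 - θ(p)⁻¹φ(v̄)⁻¹)` and
`(1 - ε(v̄)) = (1 - θ(p)φ(v)p⁻¹)` — Katz 1978 (5.3.5) "`(1 - χ(𝔭̄))(1 - χ̌(𝔭̄))`" with the dual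
`χ̌(𝔄) = N𝔄⁻¹χ(𝔄̄)⁻¹` of (5.2.6), which is `reflect`; the factors at `w ∈ S` are `1` on both sides
for `S` = the exact ramification set of `θ_K` (`heckeValueExtZero = 0` there;
`katzAwayFactor_eq_one_of_forall_not_isUnramifiedAt`); `Γ(n+1)` on both sides (ERRATUM F-GAMMA,
p471809); `L(ε, 0) = L(θ_Kρ‖·‖, 0) = L(θ_Kφ^c, 1) = L(θ_Kφ, 1)` (`‖ϖ_𝔞‖ = N𝔞⁻¹`; `θ_K^c = θ_K`,
`L(χ^c, s) = L(χ, s)`); periods `Ω^{-2n}Ω_p^{2n}` vs `Ω_K^{-2n}Ω_p^{2n}`; the remaining ratio is the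
CONSTANT `4ζ^{n-1}`, `ζ = iδ/D_K^{1/2} ∈ μ₄`, a `p`-adic unit (`p` odd). So every witness of the
reflected de Shalit frame (at `γ_dS`) and every witness of the CGLS frame (at `γ_dS⁻¹`) prescribe, at
the SAME points, values differing by `ι'⁻¹(4ζ^{n-1})·B^{2n}` with `B = ι'⁻¹(Ω_K/Ω)·(Ω_p^{dS}/Ω_p)`: the
two frames describe the same printed object `𝓛_θ = φ⁻_{θ_K}` up to the choice of period pair. (Side
remark recorded, not used: the character class is also the same — `ρ` through the anticyclotomic tower
with `λρ` unramified at `v` is unramified everywhere, and `(p-1) ∣ n` is forced by `FactorsThroughZp`.)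

## Why the ∀-witness form says no more than print (same argument as p432386, recorded not asserted)

Print speaks of THE measure. Two witnesses `G₁, G₁'` of the same reflected frame data agree at the
points `r_ρ(γ) - 1`, which accumulate at `0` (`ρ = ρ₀^{(p-1)p^k}`), so `G₁ = G₁'` by the identity
principle for bounded series (kernel: `X11b.R1.intSeries_eq_of_hasValueAt`, Summits side); two witnesses
for DIFFERENT period data `(Ω, δ, Ω_p)`, `(Ω', δ', Ω_p')` differ pointwise by `A·B^{n}`-type factors,
which a bounded series interpolates only if `‖B‖ = 1` and `n ↦ Bⁿ` is `p`-adically continuous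
(else, by continuity of evaluation and the non-vanishing of `L(θ_Kφ, 1)` on the line `re s = 1`, no
second witness exists), in which case the two witnesses differ by a UNIT `c·(1+T)^s` of `𝒪_{ℂ_p}⟦T⟧`
and `HasUnitContent` agrees (`hasUnitContent_congr_of_associated`). The twist is required UNRAMIFIED at
`p` (binder "`θ` unramified at `p`", CGLS "`p ∤ C`"): for a twist tamely ramified at `v` the typed
frame is vacuous ((R4) of the functional-equation file) and an ∀-witness statement would over-claim;
and `S` is required to be the EXACT ramification set of `θ_K` (all its primes lie over primes `ℓ ∣ C`
split in `K` — Hida's `ℑ = 1` — by the Heegner hypothesis on `C`): dropping a ramified prime from `S`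
makes the frame vacuous, adding an INERT prime `w` multiplies the branch by the constant Euler factor
`1 - θ_K(w)Nw⁻¹` (inert primes split completely in `K_∞⁻`), which can be `≡ 0 mod 𝔪` — Hida's
Prop. 5.3 / Gillard: imprimitive branches at inert primes CAN have positive `μ`. Nothing about frame
rigidity is asserted as a separate statement.

## What is proved here (API; §2–§3)

* `hasUnitContent_iff_exists_norm_coeff_eq_one` (`𝒪_{ℂ_p}`: unit ⟺ norm `1`);
  `hasUnitContent_congr_of_associated` (local coefficient ring: associates have the same verdict);
  `hasUnitContent_map_iff_of_coe_eq` / `map_residue_ne_zero_iff_hasUnitContent_of_associated` — the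
  consumer's last step: for the structure map `J : ℤ_p → 𝒪_{ℂ_p}` and `Associated (g.map J) G`,
  `g mod p ≠ 0 ⟺ HasUnitContent G` (the hypothesis currency of
  `…Theorems.IwasawaTwoVariable.muLambda_of_rubin`, p464179);
* `image_complexConj_eq_of_galConj_eq`: for a `c`-invariant `θ_K` the exact ramification set is
  `c`-stable, so the conjugate modulus `S.image (c • ·)` handed over by the functional equation IS `S`;
* `ZpExtension.IsTopGenerator.isUnit_toAdd(_inv)`: a topological generator and its inverse are unit
  generators (the fact is stated for ANY unit generator `γ`, de Shalit's coordinates being fixed only up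
  to `ℤ_p^×`, II.4.17; the road reads it at `γ⁻¹`);
* `thmI_mu_katzBranch_reflect_eq_zero.hasUnitContent_of_isTopGenerator_inv` — the fact read at the
  inverse of a topological generator, in `HasUnitContent` currency (the socket's shape).

HONEST FRAMING: a named PUBLISHED theorem stated as a `Prop` (no proof in the tree: the Katz–Hida–
Tilouine measure and Hida's Zariski-density argument are far beyond Mathlib); nothing about BSD or an
elliptic curve is asserted; closes nothing by itself. Consumer chain (all kernel, BETA-SPEC §3 with
the cell's POINTER of 2026-08-26T23:56Z): (iv′) `Associated (J g(·,0)) (G.map constantCoeff)`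
(`Rubin1991.associated_map_constantCoeff_of_span_map_prod_eq`) → (F) `anticyclotomicLine_left` →
series identity `G.map constantCoeff = C·(1+T)^a·G₁` from the pointwise relation
(`X11b.R1.intSeries_eq_of_hasValueAt`, `X11b.characterSupplyAt`, `X11b.Halves.intSeries_hasValueAt_mul`,
`X11b.Halves.hasValueAt_binomialSeries_avatar`) → THIS FACT → `hasUnitContent_congr_of_associated` →
`map_residue_ne_zero_iff_hasUnitContent_of_associated` → `g(S=0) mod p ≠ 0`.

## §5 (appended 2026-08-27): the hypothesis `θ_K ∘ c = θ_K` discharged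

`KellerYin2024.IsHeckeCharOf.galConj_eq_of_restrictField`: for `θ` a character of `Γ_ℚ` unramified
almost everywhere and `θ_K` its base change (`IsHeckeCharOf ι (θ.restrictField K) θ_K`),
`HeckeCharacter.galConj σ θ_K = θ_K` for every automorphism `σ` of `K` — PROVED (rigidity of Hecke
characters + Frobenius of a restriction), with `eventually_isUnramifiedAt_of_forall_not_mem` (the
fact's binder "unramified outside `C`", `C ≠ 0`, gives "almost everywhere") and the assembled
`image_complexConj_eq_of_isHeckeCharOf`, `isUnramifiedAt_reflect_inv_iff_of_isHeckeCharOf`; and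
`IsHeckeCharOf.unique` / `.unique_of_restrictField` ("by Chebotarev such a `θ_K` is unique": two Hecke
characters attached to the same a.e.-unramified `θ'` are equal — transports `IsFiniteOrder`).

## References

* [Hida2010MuInvariant] H. Hida, *The Iwasawa `μ`-invariant of `p`-adic Hecke `L`-functions*, Ann. of
  Math. 172 (2010) 41–137: Thm. I (p. 45 = OA PDF p0006 L53–56, verbatim: "Suppose that `p > 2` and
  that `p` is unramified in `F/ℚ`. Further suppose that `ℑ = 1`. Then the `μ`-invariant of `φ⁻_ψ`
  vanishes, unless (V) is satisfied."), (V) ⟺ (M1)–(M3) (p. 45; Lemma 5.2, p. 128), (M1) "`M/F` is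
  unramified at every finite place" — false for `K/ℚ`; §1 p. 43–44 (the measure on `Z(C)`, `C` prime
  to `p`, "`C = 𝔉𝔉_cℑ`", branch characters, `φ⁻_ψ = π⁻_*φ_ψ`); p. 44: "The `L`-functions in (1.3) are
  always the primitive one"; Prop. 5.3–5.4 (p. 132–133: positive `μ` at inert/ramified conductor).
* [CastellaGrossiLeeSkinner2022] Thm. 2.1.2 and proof (arXiv:2008.02571v2 TeX L1015–1041: `𝓛_θ = π_θ`(Katz
  measure), "`χ⁻¹ = θ_K ξ 𝐍_K`"); proof of Thm. 1.2.2 (L646–648) and of Thm. 2.2.2 (L1132): "Hida's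
  result [hidamu=0]" for these `𝓛_θ`.
* [KellerYin2024] Thm. 1.2.2 (`Rubin Hida`, arXiv:2402.12781v2 TeX L676–683).
* [deShalit1987] II.4.16 (49)–(50), II.4.17 (52)–(54) (store chunk 76–78), II.6.1 (1)–(2) (store chunk
  81), II.6.4 (store chunk 84–85) — the frame, the coordinates up to `ℤ_p^×`, the involution `ε ↦ ε̌`.
* [Katz1978] (5.2.6) (p. 270: the dual `χ̌`), Thm. (5.3.0) with (5.3.5) (p. 274: the Euler factors
  `(1 - χ(𝔭̄))(1 - χ̌(𝔭̄))`).
* Cell records: HOME/k5-ty-g6/BETA-SPEC.md (sha16 94a8c4408b3e9dfe) §1–§4; HOME/k5-c2-MEMO-4.md;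
  STATUS 2026-08-26T22:59:01Z (g6), 23:56:03Z (g7 POINTER); LIT-DOSSIER §17 (a).
-/

set_option autoImplicit false

noncomputable section

open scoped Classical

open NumberField IsDedekindDomain Field
  Literature.NumberTheory.EllipticCurves Literature.NumberTheory.EllipticCurves.KellerYin2024
  Literature.NumberTheory.EllipticCurves.CastellaGrossiLeeSkinner2022
  Literature.NumberTheory.EllipticCurves.GreenbergVatsal2000
  Literature.NumberTheory.GaloisRepresentations

namespace Literature.NumberTheory.EllipticCurves.Hida2010MuInvariant

/-! ### §1. The named fact -/

/-- **Hida 2010, Theorem I (anticyclotomic `μ = 0`) for `𝓛_θ = φ⁻_{θ_K}`, on the de Shalit frame of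
the reflected twist `reflect θ_K⁻¹ = θ_K·‖·‖` along the anticyclotomic `ℤ_p`-extension** — named fact
(second currency of `thmI_mu_katzLFunction_eq_zero`; module docstring). DATA, binder for binder those
of p432386 (= CGLS Thm. 2.1.2's): `p` odd; `K` imaginary quadratic (a CM field: `[IsCMField K]`, for
`reflect`), `p = v v̄` split, `D_K` odd `≠ -3` (CGLS §2 standing); `v` cut out by `ι` and induced by
`ι'`; `κ` ANTICYCLOTOMIC and `γ` ANY unit generator (`κ(γ) ∈ ℤ_p^×`: de Shalit's coordinate is fixed up
to `ℤ_p^×`, II.4.17; the road reads it at the inverse of a topological generator); `θ : G_ℚ → GL₁(ℤ_p)`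
Teichmüller-valued (`θ^{p-1} = 1`), unramified outside a Heegner integer `C` (Hida's `ℑ = 1`: every
prime of the branch conductor lies over a prime split in `K`) and AT `p` (CGLS "`p ∤ C`"); `θ_K` its
Hecke character (`IsHeckeCharOf`, arithmetic); `S` = the EXACT set of places where `θ_K` ramifies
(de Shalit's modulus `𝔣 = S^∞v̄^∞`; primitive branch — Hida p. 44 "always the primitive one"); and
EVERY de Shalit datum `(Ω ≠ 0, δ² = ±d_K, Ω_p ∈ R₀^×, G₁ ∈ 𝒪_{ℂ_p}⟦T⟧)` with
`DeShalit1987.IsKatzBranch ι' v v̄ S κ γ (DeShalit1987.reflect θ_K⁻¹) Ω δ Ω_p G₁`. CONCLUSION: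
`μ(G₁) = 0` in residue currency — `G₁ mod 𝔪_{𝒪_{ℂ_p}} ≠ 0`, i.e.
`G₁.map (IsLocalRing.residue 𝒪_{ℂ_p}) ≠ 0` (⟺ some coefficient of `G₁` is a unit of `𝒪_{ℂ_p}`,
`HasUnitContent G₁`, ⟺ some coefficient has norm `1`; §2). PRINT (p. 45): "Suppose that `p > 2` and that `p` is unramified in `F/ℚ`. Further suppose
that `ℑ = 1`. Then the `μ`-invariant of `φ⁻_ψ` vanishes, unless (V) is satisfied", (V) ⟺ (M1)–(M3)
(Lemma 5.2) with (M1) "`M/F` is unramified at every finite place" — false for `M/F = K/ℚ`, so the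
vanishing is unconditional here; `φ⁻_{θ_K}` is CGLS's `𝓛_θ` by CGLS's construction (proof of
Thm. 2.1.2: `𝓛_θ = π_θ`(Katz measure)), whose interpolation data are those of the reflected de Shalit
frame up to the constant unit `4ζ^{n-1}` and the period pair (module docstring). PUBLISHED.
[cite: Hida2010MuInvariant, Thm. I (p. 45) with Lemma 5.2 ((V) ⟺ (M1)–(M3), p. 128) and §1 p. 43–44 (Z(C), ℑ, branch characters, φ⁻_ψ)]
[cite: CastellaGrossiLeeSkinner2022, Thm. 2.1.2 and its proof (arXiv:2008.02571v2 TeX L1015–1041: 𝓛_θ = π_θ(Katz measure), "χ⁻¹ = θ_K ξ 𝐍_K") and proof of Thm. 2.2.2 (L1132): "Hida's result [hidamu=0]"]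
[cite: KellerYin2024, Thm. 1.2.2 (`Rubin Hida`, arXiv:2402.12781v2 TeX L676–683)]
[cite: deShalit1987, II.4.16 (49)–(50) and II.4.17 (52)–(53) (store chunk 76–78); II.6.1 (1)–(2) (store chunk 81)]
[cite: Katz1978, (5.2.6) (p. 270) and Thm. (5.3.0) eq. (5.3.5) (p. 274)] -/
def thmI_mu_katzBranch_reflect_eq_zero : Prop :=
  ∀ (p : ℕ) [Fact p.Prime], 2 < p →
    ∀ (K : Type) [Field K] [NumberField K] [IsCMField K], IsImaginaryQuadratic K →
      SatisfiesHeegnerHypothesis p K → Odd (NumberField.discr K) → NumberField.discr K ≠ -3 →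
    ∀ (ι : K →+* ℚ_[p]) (v vbar : HeightOneSpectrum (𝓞 K)),
      (∀ x : 𝓞 K, x ∈ v.asIdeal ↔ ‖ι (x : K)‖ < 1) →
      ((p : ℕ) : 𝓞 K) ∈ vbar.asIdeal → vbar ≠ v →
    ∀ (κ : ZpExtension K p), κ.IsAnticyclotomic →
    ∀ (γ : absoluteGaloisGroup K), IsUnit (κ γ).toAdd →
    ∀ (ι' : PadicAlgCl p ≃+* ℂ),
      (∀ (w : InfinitePlace K) (k : 𝓞 K), k ∈ v.asIdeal ↔ ‖ι'.symm (w.embedding (k : K))‖ < 1) →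
    ∀ (θ : FramedGaloisRep ℚ (padicCoeffIntegers (∅ : Set (PadicAlgCl p))) 1),
      (∀ σ : absoluteGaloisGroup ℚ, θ σ ^ (p - 1) = 1) →
    ∀ (C : ℕ), SatisfiesHeegnerHypothesis C K →
      (∀ u : HeightOneSpectrum (𝓞 ℚ), ((C : ℤ) : 𝓞 ℚ) ∉ u.asIdeal → θ.IsUnramifiedAt u) →
      (∀ u : HeightOneSpectrum (𝓞 ℚ), ((p : ℕ) : 𝓞 ℚ) ∈ u.asIdeal → θ.IsUnramifiedAt u) →
    ∀ (θK : HeckeCharacter K), IsHeckeCharOf ι' (θ.restrictField K) θK →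
    ∀ (S : Finset (HeightOneSpectrum (𝓞 K))),
      (∀ w : HeightOneSpectrum (𝓞 K), w ∈ S ↔ ¬ θK.IsUnramifiedAt w) →
    ∀ (Ω δ : ℂ) (Ωp : (unrIntegers p)ˣ) (G₁ : PowerSeries (PadicComplexInt p)), Ω ≠ 0 →
      (δ ^ 2 = (NumberField.discr K : ℂ) ∨ δ ^ 2 = -(NumberField.discr K : ℂ)) →
      DeShalit1987.IsKatzBranch ι' v vbar S κ γ (DeShalit1987.reflect θK⁻¹) Ω δ
        ((Ωp : unrIntegers p) : ℂ_[p]) G₁ →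
    PowerSeries.map (IsLocalRing.residue (PadicComplexInt p)) G₁ ≠ 0

/-! ### §2. Proved API: the `μ = 0` token on `𝒪_{ℂ_p}⟦T⟧` and its transport to `ℤ_p⟦T⟧` -/

section UnitContent

variable {p : ℕ} [Fact p.Prime]

/-- On `𝒪_{ℂ_p}⟦T⟧`, "some coefficient is a unit" ⟺ "some coefficient has norm `1`" (units of
`𝒪_{ℂ_p}` are the elements of norm `1`, `isUnit_padicComplexInt_iff`).
[cite: GreenbergVatsal2000, p. 2, (1)–(2)] -/
theorem hasUnitContent_iff_exists_norm_coeff_eq_one (G : PowerSeries (PadicComplexInt p)) :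
    HasUnitContent G ↔ ∃ n : ℕ, ‖((PowerSeries.coeff n G : PadicComplexInt p) : ℂ_[p])‖ = 1 :=
  exists_congr fun _ ↦ isUnit_padicComplexInt_iff

/-- **Associated power series over a LOCAL coefficient ring have the same unit-content verdict**
(`g' = g·U` with `U` a unit of `R⟦T⟧`; `hasUnitContent_mul_iff_of_isUnit`: reduce modulo the maximal
ideal, where `Ū` is a unit of the domain `k⟦T⟧`). [cite: GreenbergVatsal2000, p. 2, (2)] -/
theorem hasUnitContent_congr_of_associated {R : Type*} [CommRing R] [IsLocalRing R]
    {g g' : PowerSeries R} (h : Associated g g') : HasUnitContent g ↔ HasUnitContent g' := by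
  obtain ⟨u, rfl⟩ := h
  rw [mul_comm, hasUnitContent_mul_iff_of_isUnit u.isUnit]

/-- **Unit content is invariant under the structure map `J : ℤ_p → 𝒪_{ℂ_p}`** (any ring map
compatible with `ℤ_p ⊂ ℚ_p ⊂ ℂ_p`, the clause of
`…Theorems.IwasawaTwoVariable.muLambda_of_rubin`): a coefficient of `g ∈ ℤ_p⟦T⟧` is a unit iff it has
norm `1` iff its image in `𝒪_{ℂ_p}` has norm `1` iff that image is a unit.
[cite: GreenbergVatsal2000, p. 2, (1)–(2)] -/
theorem hasUnitContent_map_iff_of_coe_eq {J : ℤ_[p] →+* PadicComplexInt p}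
    (hJ : ∀ x : ℤ_[p], ((J x : PadicComplexInt p) : ℂ_[p]) = ((x : ℚ_[p]) : ℂ_[p]))
    (g : PowerSeries ℤ_[p]) :
    HasUnitContent (PowerSeries.map J g) ↔ HasUnitContent g := by
  refine exists_congr fun n ↦ ?_
  rw [PowerSeries.coeff_map, isUnit_padicComplexInt_iff, hJ, PadicComplex.norm_extends' p,
    PadicInt.padic_norm_e_of_padicInt, PadicInt.isUnit_iff]

/-- **The consumer's last step, packaged**: for the structure map `J : ℤ_p → 𝒪_{ℂ_p}` and
`Associated (g.map J) G` in `𝒪_{ℂ_p}⟦T⟧` (e.g. `g = g(·, 0)`, `G` = the anticyclotomic slice of the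
two-variable frame, `Rubin1991.associated_map_constantCoeff_of_span_map_prod_eq`), "`g mod p ≠ 0`"
(`g.map (IsLocalRing.residue ℤ_p) ≠ 0`, the hypothesis of `muLambda_of_rubin`) ⟺ `HasUnitContent G`.
[cite: GreenbergVatsal2000, p. 2, (1)–(2)] -/
theorem map_residue_ne_zero_iff_hasUnitContent_of_associated {J : ℤ_[p] →+* PadicComplexInt p}
    (hJ : ∀ x : ℤ_[p], ((J x : PadicComplexInt p) : ℂ_[p]) = ((x : ℚ_[p]) : ℂ_[p]))
    {g : PowerSeries ℤ_[p]} {G : PowerSeries (PadicComplexInt p)}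
    (h : Associated (PowerSeries.map J g) G) :
    PowerSeries.map (IsLocalRing.residue ℤ_[p]) g ≠ 0 ↔ HasUnitContent G := by
  rw [← hasUnitContent_iff_map_residue_ne_zero, ← hasUnitContent_map_iff_of_coe_eq hJ g,
    hasUnitContent_congr_of_associated h]

/-- Residue form on `𝒪_{ℂ_p}⟦T⟧`: `HasUnitContent G ↔ G mod 𝔪_{𝒪_{ℂ_p}} ≠ 0` (the instance of
`hasUnitContent_iff_map_residue_ne_zero` the cell quotes; `𝒪_{ℂ_p}` is a valuation ring, hence local).
[cite: GreenbergVatsal2000, p. 2, (2)] -/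
theorem hasUnitContent_iff_map_residue_padicComplexInt_ne_zero (G : PowerSeries (PadicComplexInt p)) :
    HasUnitContent G ↔ PowerSeries.map (IsLocalRing.residue (PadicComplexInt p)) G ≠ 0 :=
  hasUnitContent_iff_map_residue_ne_zero G

end UnitContent

/-! ### §3. Proved API: the exact ramification set under complex conjugation; unit generators -/

section Ramification

variable {K : Type} [Field K] [NumberField K] [IsCMField K]

/-- **For a `c`-invariant Hecke character the exact ramification set is `c`-stable**: if
`θ_K ∘ c = θ_K` (e.g. `θ_K = θ ∘ Nm` from `G_ℚ`) and `S = {w : θ_K ramified at w}`, then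
`S.image (c • ·) = S` — so the conjugate modulus `𝔣̄` delivered by de Shalit's functional equation
("`𝔣_ε̌ = 𝔣̄_ε`", II.6.1; `thmII64_katzMeasure₂_functionalEquation` hands over `S.image (c • ·)`) is
again the exact ramification set of `θ_K` (and of `reflect θ_K⁻¹ = θ_K‖·‖`, the norm character being
unramified everywhere). [cite: deShalit1987, II.6.1 (1) (store chunk 81)] -/
theorem image_complexConj_eq_of_galConj_eq {θK : HeckeCharacter K}
    (hθ : HeckeCharacter.galConj (IsCMField.complexConj K) θK = θK)
    {S : Finset (HeightOneSpectrum (𝓞 K))}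
    (hS : ∀ w : HeightOneSpectrum (𝓞 K), w ∈ S ↔ ¬ θK.IsUnramifiedAt w) :
    S.image (fun w ↦ IsCMField.complexConj K • w) = S := by
  have hconj : ∀ w : HeightOneSpectrum (𝓞 K),
      θK.IsUnramifiedAt (IsCMField.complexConj K • w) ↔ θK.IsUnramifiedAt w := fun w ↦ by
    rw [← HeckeCharacter.isUnramifiedAt_galConj_iff, hθ]
  ext w
  simp only [Finset.mem_image]
  constructor
  · rintro ⟨u, hu, rfl⟩
    rw [hS] at hu ⊢
    rwa [hconj]
  · intro hw
    refine ⟨IsCMField.complexConj K • w, ?_, ?_⟩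
    · rw [hS] at hw ⊢
      rwa [hconj]
    · rw [smul_smul, HeckeCharacter.complexConj_mul_self, one_smul]

/-- The reflected twist of a `c`-invariant `θ_K` ramifies exactly where `θ_K` does:
`(reflect θ_K⁻¹ = θ_K‖·‖)` is unramified at `w` iff `θ_K` is (`isUnramifiedAt_reflect_iff`, the
`c`-stability above at the level of places, `‖·‖` unramified everywhere).
[cite: deShalit1987, II.6.1 (1) (store chunk 81)] -/
theorem isUnramifiedAt_reflect_inv_iff_of_galConj_eq {θK : HeckeCharacter K}
    (hθ : HeckeCharacter.galConj (IsCMField.complexConj K) θK = θK)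
    (w : HeightOneSpectrum (𝓞 K)) :
    (DeShalit1987.reflect θK⁻¹).IsUnramifiedAt w ↔ θK.IsUnramifiedAt w := by
  rw [DeShalit1987.reflect_inv_of_galConj_eq hθ]
  constructor
  · intro h
    have h' := h.mul' (HeckeCharacter.isUnramifiedAt_normCharacter' w).inv'
    rwa [mul_inv_cancel_right] at h'
  · intro h
    exact h.mul' (HeckeCharacter.isUnramifiedAt_normCharacter' w)

end Ramification

section Generators

variable {K : Type} [Field K] {p : ℕ} [Fact p.Prime]

/-- A topological generator (`κ(γ) = 1 ∈ ℤ_p`) is a unit generator. [cite: deShalit1987, II.4.17 (store chunk 77–78)] -/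
theorem _root_.Literature.NumberTheory.EllipticCurves.ZpExtension.IsTopGenerator.isUnit_toAdd
    {κ : ZpExtension K p} {γ : absoluteGaloisGroup K} (h : κ.IsTopGenerator γ) :
    IsUnit (κ γ).toAdd := by
  rw [show κ γ = Multiplicative.ofAdd 1 from h, toAdd_ofAdd]
  exact isUnit_one

/-- The INVERSE of a topological generator is a unit generator (`κ(γ⁻¹) = -1`) — the coordinate at
which the two-variable road reads the anticyclotomic branch (Rubin's frame at the inverse generators).
[cite: deShalit1987, II.4.17 (store chunk 77–78)] -/
theorem _root_.Literature.NumberTheory.EllipticCurves.ZpExtension.IsTopGenerator.isUnit_toAdd_inv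
    {κ : ZpExtension K p} {γ : absoluteGaloisGroup K} (h : κ.IsTopGenerator γ) :
    IsUnit (κ γ⁻¹).toAdd := by
  rw [map_inv, toAdd_inv]
  exact h.isUnit_toAdd.neg

end Generators

/-! ### §4. The fact read at the inverse of a topological generator, in `HasUnitContent` currency -/

section Corollaries

variable {p : ℕ} [Fact p.Prime] {K : Type} [Field K] [NumberField K] [IsCMField K]

/-- **Granted the fact: the socket shape of the two-variable road.** At the data of
`thmI_mu_katzBranch_reflect_eq_zero` with `γ` a TOPOLOGICAL generator of the anticyclotomic `κ`
(`[Fact (κ.IsTopGenerator γ)]`, as in p432386 / `CharMainConjOnTree`), every witness `G₁` of the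
reflected de Shalit frame AT `γ⁻¹` — the coordinate delivered by
`DeShalit1987.thmII64_katzMeasure₂_functionalEquation.anticyclotomicLine_left` from Rubin's frame at
the inverse generators — has unit content: some coefficient of `G₁` is a unit of `𝒪_{ℂ_p}` (so
`hasUnitContent_congr_of_associated` / `map_residue_ne_zero_iff_hasUnitContent_of_associated` apply
downstream). Unfolding only (`isUnit_toAdd_inv`, `hasUnitContent_iff_map_residue_ne_zero`).
[cite: Hida2010MuInvariant, Thm. I (p. 45)]
[cite: deShalit1987, II.4.17 (store chunk 77–78) and II.6.4 (store chunk 84–85)] -/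
theorem thmI_mu_katzBranch_reflect_eq_zero.hasUnitContent_of_isTopGenerator_inv
    (h : thmI_mu_katzBranch_reflect_eq_zero) (hp : 2 < p) (hK : IsImaginaryQuadratic K)
    (hHp : SatisfiesHeegnerHypothesis p K) (hodd : Odd (NumberField.discr K))
    (h3 : NumberField.discr K ≠ -3) {ι : K →+* ℚ_[p]} {v vbar : HeightOneSpectrum (𝓞 K)}
    (hιv : ∀ x : 𝓞 K, x ∈ v.asIdeal ↔ ‖ι (x : K)‖ < 1) (hvbar : ((p : ℕ) : 𝓞 K) ∈ vbar.asIdeal)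
    (hne : vbar ≠ v) {κ : ZpExtension K p} (hκ : κ.IsAnticyclotomic) {γ : absoluteGaloisGroup K}
    [hγ : Fact (κ.IsTopGenerator γ)] {ι' : PadicAlgCl p ≃+* ℂ}
    (hι' : ∀ (w : InfinitePlace K) (k : 𝓞 K), k ∈ v.asIdeal ↔ ‖ι'.symm (w.embedding (k : K))‖ < 1)
    {θ : FramedGaloisRep ℚ (padicCoeffIntegers (∅ : Set (PadicAlgCl p))) 1}
    (hθ : ∀ σ : absoluteGaloisGroup ℚ, θ σ ^ (p - 1) = 1) {C : ℕ} (hC : SatisfiesHeegnerHypothesis C K)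
    (hθC : ∀ u : HeightOneSpectrum (𝓞 ℚ), ((C : ℤ) : 𝓞 ℚ) ∉ u.asIdeal → θ.IsUnramifiedAt u)
    (hθp : ∀ u : HeightOneSpectrum (𝓞 ℚ), ((p : ℕ) : 𝓞 ℚ) ∈ u.asIdeal → θ.IsUnramifiedAt u)
    {θK : HeckeCharacter K} (hθK : IsHeckeCharOf ι' (θ.restrictField K) θK)
    {S : Finset (HeightOneSpectrum (𝓞 K))}
    (hS : ∀ w : HeightOneSpectrum (𝓞 K), w ∈ S ↔ ¬ θK.IsUnramifiedAt w)
    {Ω δ : ℂ} {Ωp : (unrIntegers p)ˣ} {G₁ : PowerSeries (PadicComplexInt p)} (hΩ : Ω ≠ 0)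
    (hδ : δ ^ 2 = (NumberField.discr K : ℂ) ∨ δ ^ 2 = -(NumberField.discr K : ℂ))
    (hG₁ : DeShalit1987.IsKatzBranch ι' v vbar S κ γ⁻¹ (DeShalit1987.reflect θK⁻¹) Ω δ
      ((Ωp : unrIntegers p) : ℂ_[p]) G₁) :
    HasUnitContent G₁ :=
  (hasUnitContent_iff_map_residue_ne_zero G₁).mpr
    (h p hp K hK hHp hodd h3 ι v vbar hιv hvbar hne κ hκ γ⁻¹ hγ.out.isUnit_toAdd_inv ι' hι' θ hθ C hC
      hθC hθp θK hθK S hS Ω δ Ωp G₁ hΩ hδ hG₁)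

end Corollaries

/-! ### §5. Proved API: the base change to `K` of a character of `Γ_ℚ` is `Aut(K)`-invariant

The displayed hypothesis `θ_K ∘ c = θ_K` of §3 (`image_complexConj_eq_of_galConj_eq`,
`isUnramifiedAt_reflect_inv_iff_of_galConj_eq`, and `DeShalit1987.reflect_inv_of_galConj_eq`) is
DISCHARGED for the `θ_K` of the fact: `θ_K` is "the base change of `θ` to `K`"
(Castella–Grossi–Lee–Skinner, §2.2: "`φ_K` denotes the base change of `φ` to `K`"; the tree's
`KellerYin2024.IsHeckeCharOf ι (θ.restrictField K) θ_K`), and for `θ` a character of `Γ_ℚ` unramified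
almost everywhere, `θ_K ∘ σ = θ_K` for EVERY automorphism `σ` of `K` (over any subfield `F₀`; for the
cell, `σ = c`).  Proof (rigidity, Cassels–Fröhlich VII §4 Prop. 4.1: a Hecke character is determined by
its values at almost all uniformisers, `HeckeCharacter.ext_of_eventually_valueAtUniformizer_eq`): at a
place `w` of `K` over a rational prime `ℓ` at which `θ` is unramified, `(θ_K ∘ σ)(ϖ_w) = θ_K(ϖ_{σw})`
(`valueAtUniformizer_galConj_of_isUnramifiedAt`), and `θ_K(ϖ_{w'}) = ι(θ(Frob_ℓ)^{f(w'|ℓ)})` for EVERY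
`w' ∣ ℓ` (`IsHeckeCharOf` read through `FramedGaloisRep.exists_restrictField_apply_eq_pow`:
`θ|_{Γ_K}(Frob_{w'}) = θ(Frob_ℓ)^{f(w'|ℓ)}`, Serre 1968 Ch. I §2.1, the value `θ(Frob_ℓ)` being
independent of the prime above `ℓ` because `θ` is unramified there), while `σ w ∣ ℓ` with
`f(σw|ℓ) = f(w|ℓ)` (Cassels–Fröhlich VII §1.1; `HeightOneSpectrum.under_smul`, `inertiaDeg_smul` — the
automorphisms of `K` fix `ℤ = 𝓞_ℚ`).  Also: the binder "`θ` unramified outside `C`" of the fact gives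
"unramified almost everywhere" (`eventually_isUnramifiedAt_of_forall_not_mem`, `C ≠ 0`), and the
assembled `image_complexConj_eq_of_isHeckeCharOf`. -/

section BaseChange

open Filter Literature.NumberTheory.Automorphic

variable {F₀ K : Type} [Field F₀] [Field K] [NumberField K] [Algebra F₀ K]

/-- The automorphisms of `K` fix the image of `𝓞_ℚ = ℤ` in `𝓞_K`. [folklore] -/
private theorem algEquiv_smul_algebraMap_ringOfIntegers_rat (σ : K ≃ₐ[F₀] K) (a : 𝓞 ℚ) :
    σ • algebraMap (𝓞 ℚ) (𝓞 K) a = algebraMap (𝓞 ℚ) (𝓞 K) a := by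
  have h : algebraMap (𝓞 ℚ) (𝓞 K) a = ((Rat.ringOfIntegersEquiv a : ℤ) : 𝓞 K) := by
    have hext := RingHom.ext_int
      ((algebraMap (𝓞 ℚ) (𝓞 K)).comp Rat.ringOfIntegersEquiv.symm.toRingHom) (Int.castRingHom (𝓞 K))
    have h1 := RingHom.congr_fun hext (Rat.ringOfIntegersEquiv a)
    rw [RingHom.comp_apply, RingEquiv.toRingHom_eq_coe, RingHom.coe_coe,
      RingEquiv.symm_apply_apply, Int.coe_castRingHom] at h1
    exact h1
  rw [h, ← MulSemiringAction.toRingHom_apply, map_intCast]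

/-- `Aut(K/F₀)` commutes with the `𝓞_ℚ`-algebra structure of `𝓞_K` (the `SMulCommClass` hypothesis
of Mathlib's `Ideal.under_smul` / `Ideal.inertiaDeg_smul`; a theorem, supplied locally with `haveI`,
nothing registered globally). [folklore] -/
private theorem smulCommClass_algEquiv_ringOfIntegers_rat :
    SMulCommClass (K ≃ₐ[F₀] K) (𝓞 ℚ) (𝓞 K) :=
  ⟨fun σ a b ↦ by
    rw [Algebra.smul_def, Algebra.smul_def, smul_mul', algEquiv_smul_algebraMap_ringOfIntegers_rat]⟩

/-- `(M^k)₀₀ = (M₀₀)^k` for `1 × 1` matrices. [folklore] -/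
private theorem matrix_fin_one_pow_apply {R : Type*} [CommRing R] (M : Matrix (Fin 1) (Fin 1) R)
    (k : ℕ) : (M ^ k) 0 0 = M 0 0 ^ k := by
  induction k with
  | zero => simp
  | succ k ih => rw [pow_succ, Matrix.mul_apply, Fin.sum_univ_one, ih, pow_succ]

/-- The places of `K` above the finitely many exceptional rational primes are finitely many
(`primesOver_finite`). [folklore] -/
private theorem eventually_under_of_eventually {P : HeightOneSpectrum (𝓞 ℚ) → Prop}
    (h : ∀ᶠ u : HeightOneSpectrum (𝓞 ℚ) in cofinite, P u) :
    ∀ᶠ w : HeightOneSpectrum (𝓞 K) in cofinite, P (HeightOneSpectrum.under (𝓞 ℚ) w) := by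
  rw [Filter.eventually_cofinite] at h ⊢
  have hfib : ∀ u : HeightOneSpectrum (𝓞 ℚ),
      {w : HeightOneSpectrum (𝓞 K) | HeightOneSpectrum.under (𝓞 ℚ) w = u}.Finite := by
    intro u
    haveI : u.asIdeal.IsMaximal := u.isMaximal
    have hfin := IsDedekindDomain.primesOver_finite u.asIdeal (𝓞 K)
    refine (hfin.preimage (Set.injOn_of_injective (fun w w' h ↦ HeightOneSpectrum.ext h))).subset ?_
    intro w hw
    simp only [Set.mem_setOf_eq] at hw
    simp only [Set.mem_preimage]
    refine ⟨w.isPrime, ⟨?_⟩⟩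
    rw [← hw, HeightOneSpectrum.under_asIdeal]
  refine (h.biUnion fun u _ ↦ hfib u).subset ?_
  intro w hw
  exact Set.mem_biUnion hw rfl

/-- **"Unramified outside `C`" ⟹ unramified almost everywhere** (`C ≠ 0`: the primes dividing `C`
are finitely many, Mathlib `Ideal.finite_factors`) — turns the binder of the fact into the hypothesis
of `IsHeckeCharOf.galConj_eq_of_restrictField`. [cite: SerreAbelianLadic1968, Ch. I §2.1 (a representation unramified outside a finite set S)] -/
theorem eventually_isUnramifiedAt_of_forall_not_mem {A : Type*} [CommRing A] [TopologicalSpace A]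
    {n : ℕ} (θ : FramedGaloisRep ℚ A n) {C : ℕ} (hC : C ≠ 0)
    (h : ∀ u : HeightOneSpectrum (𝓞 ℚ), ((C : ℤ) : 𝓞 ℚ) ∉ u.asIdeal → θ.IsUnramifiedAt u) :
    ∀ᶠ u : HeightOneSpectrum (𝓞 ℚ) in cofinite, θ.IsUnramifiedAt u := by
  rw [Filter.eventually_cofinite]
  have hC' : Ideal.span {((C : ℤ) : 𝓞 ℚ)} ≠ ⊥ := by
    rw [Ne, Ideal.span_singleton_eq_bot]
    exact_mod_cast hC
  refine (Ideal.finite_factors hC').subset ?_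
  intro u hu
  simp only [Set.mem_setOf_eq] at hu ⊢
  rw [Ideal.dvd_span_singleton]
  by_contra hmem
  exact hu (h u hmem)

variable {p : ℕ} [Fact p.Prime]

/-- Local replica of the accepted `FramedGaloisRep.IsUnramifiedAt.hasFrobCharpolyAt_charpoly`
(`GaloisRepresentations/ResidualPairIntegrality`, not in this file's import cone; same five-line proof
through `ρ.toGaloisRep`): at an unramified place the characteristic polynomial of ANY arithmetic
Frobenius at ANY prime above it is a Frobenius polynomial.  Serre 1968, Ch. I §2.1 ("`P_{v,ρ}` depends
only on `v`"). [cite: SerreAbelianLadic1968, Ch. I §2.1] -/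
private theorem hasFrobCharpolyAt_charpoly_of_isUnramifiedAt {L : Type} [Field L] [NumberField L]
    {A : Type*} [CommRing A] [TopologicalSpace A] [IsTopologicalRing A] {n : ℕ}
    {v : HeightOneSpectrum (𝓞 L)} {ρ : FramedGaloisRep L A n} (h : ρ.IsUnramifiedAt v)
    {𝔓 : Ideal (absIntegers (𝓞 L) L)} (h𝔓 : 𝔓 ∈ v.primesAbove) {g : absoluteGaloisGroup L}
    (hg : IsArithFrobAt (𝓞 L) g 𝔓) : ρ.HasFrobCharpolyAt v (FramedRep.charpoly ρ g) := by
  have hQ : ρ.HasFrobCharpolyAt v (ρ.toGaloisRep g).charpoly :=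
    (FramedGaloisRep.hasFrobCharpolyAt_toGaloisRep_iff v _ ρ).mp
      (((FramedGaloisRep.isUnramifiedAt_toGaloisRep_iff v ρ).mpr h).hasFrobCharpolyAt_charpoly h𝔓 hg)
  rw [hQ 𝔓 h𝔓 g hg]
  exact hQ

/-- **The base change to `K` of a character of `Γ_ℚ` is invariant under the automorphisms of `K`.**
Let `θ : Γ_ℚ → 𝒪^× ⊂ ℚ̄_p^×` be a continuous character unramified at almost all primes, `K` a number
field, and `θ_K` a Hecke character of `K` attached to `θ|_{Γ_K}` by arithmetic reciprocity read through
`ι : ℚ̄_p ≃ ℂ` (`IsHeckeCharOf ι (θ.restrictField K) θ_K`: `θ_K(ϖ_w) = ι(θ|_{Γ_K}(Frob_w))` wherever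
`θ|_{Γ_K}` is unramified — "the base change of `θ` to `K`", CGLS §2.2).  Then `θ_K ∘ σ = θ_K`
(`HeckeCharacter.galConj σ θ_K = θ_K`) for every `σ ∈ Aut(K/F₀)`, any `F₀` — in particular for the
complex conjugation of a CM field.  Proof in the section docstring: rigidity (Cassels–Fröhlich VII §4
Prop. 4.1) and `θ_K(ϖ_{w'}) = ι(θ(Frob_ℓ))^{f(w'|ℓ)}` at every `w' ∣ ℓ`, `θ` unramified at `ℓ`
(Serre 1968 Ch. I §2.1), with `σw ∣ ℓ`, `f(σw|ℓ) = f(w|ℓ)` (Cassels–Fröhlich VII §1.1).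
[cite: CasselsFrohlichANT1967, Ch. VII §4 Prop. 4.1 (a Hecke character is determined by almost all ψ(𝔭_v)) and §1.1 (action of automorphisms on primes)]
[cite: SerreAbelianLadic1968, Ch. I §2.1 (Frobenius of the restriction; P_{v,ρ} depends only on v)]
[cite: CastellaGrossiLeeSkinner2022, §2.2 ("φ_K denotes the base change of φ to K"; arXiv:2008.02571v2, store p0012 L69) with Thm. 2.1.2 (θ_K)] -/
theorem _root_.Literature.NumberTheory.EllipticCurves.KellerYin2024.IsHeckeCharOf.galConj_eq_of_restrictField
    (ι : PadicAlgCl p ≃+* ℂ) {S : Set (PadicAlgCl p)}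
    {θ : FramedGaloisRep ℚ (padicCoeffIntegers S) 1}
    (hθ : ∀ᶠ u : HeightOneSpectrum (𝓞 ℚ) in cofinite, θ.IsUnramifiedAt u)
    {θK : HeckeCharacter K} (hθK : IsHeckeCharOf ι (θ.restrictField K) θK) (σ : K ≃ₐ[F₀] K) :
    HeckeCharacter.galConj σ θK = θK := by
  haveI : SMulCommClass (K ≃ₐ[F₀] K) (𝓞 ℚ) (𝓞 K) := smulCommClass_algEquiv_ringOfIntegers_rat
  apply HeckeCharacter.ext_of_eventually_valueAtUniformizer_eq
  filter_upwards [eventually_under_of_eventually (K := K) hθ] with w hw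
  set v : HeightOneSpectrum (𝓞 ℚ) := HeightOneSpectrum.under (𝓞 ℚ) w with hvdef
  have hwv : w.asIdeal.under (𝓞 ℚ) = v.asIdeal := (HeightOneSpectrum.under_asIdeal (𝓞 ℚ) w).symm
  have hσwv : (σ • w).asIdeal.under (𝓞 ℚ) = v.asIdeal := by
    rw [← HeightOneSpectrum.under_asIdeal, HeightOneSpectrum.under_smul]
  have hur : (θ.restrictField K).IsUnramifiedAt w := θ.isUnramifiedAt_restrictField hwv hw
  have hurσ : (θ.restrictField K).IsUnramifiedAt (σ • w) := θ.isUnramifiedAt_restrictField hσwv hw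
  rw [HeckeCharacter.valueAtUniformizer_galConj_of_isUnramifiedAt σ θK w (hθK (σ • w) hurσ).1]
  -- a well-defined Frobenius value `a = θ(Frob_ℓ)` of `θ` at `v`
  obtain ⟨𝔓₀, h𝔓₀⟩ := v.primesAbove_nonempty
  obtain ⟨φ₀, hφ₀⟩ := HeightOneSpectrum.exists_isArithFrobAt_of_mem_primesAbove_holds h𝔓₀
  set a : padicCoeffIntegers S :=
    ((θ φ₀ : GL (Fin 1) (padicCoeffIntegers S)) : Matrix (Fin 1) (Fin 1) (padicCoeffIntegers S)) 0 0
    with hadef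
  have hθa : θ.HasFrobCharpolyAt v (Polynomial.X - Polynomial.C a) := by
    have h := hasFrobCharpolyAt_charpoly_of_isUnramifiedAt hw h𝔓₀ hφ₀
    rwa [FramedGaloisRep.charpoly_eq_of_rank_one] at h
  -- the restriction has Frobenius value `a ^ f(w'|v)` at every `w' ∣ v`
  have key : ∀ w' : HeightOneSpectrum (𝓞 K), w'.asIdeal.under (𝓞 ℚ) = v.asIdeal →
      (θ.restrictField K).HasFrobCharpolyAt w'
        (Polynomial.X - Polynomial.C (a ^ w'.asIdeal.inertiaDeg (𝓞 ℚ))) := by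
    intro w' hw'
    rw [FramedGaloisRep.hasFrobCharpolyAt_iff_of_rank_one]
    intro 𝔔 h𝔔 τ hτ
    obtain ⟨𝔓, h𝔓, φ, hφ, heq⟩ := θ.exists_restrictField_apply_eq_pow hw' hw h𝔔 hτ
    have hφa : ((θ φ : GL (Fin 1) (padicCoeffIntegers S)) :
        Matrix (Fin 1) (Fin 1) (padicCoeffIntegers S)) 0 0 = a :=
      (FramedGaloisRep.hasFrobCharpolyAt_iff_of_rank_one θ v a).mp hθa 𝔓 h𝔓 φ hφ
    rw [heq, Units.val_pow_eq_pow_val, matrix_fin_one_pow_apply, hφa]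
  rw [(hθK w hur).2 _ (key w hwv), (hθK (σ • w) hurσ).2 _ (key (σ • w) hσwv),
    HeightOneSpectrum.inertiaDeg_smul]

/-- **The exact ramification set of the base change `θ_K` is `c`-stable** — §3's
`image_complexConj_eq_of_galConj_eq` with its hypothesis discharged by
`IsHeckeCharOf.galConj_eq_of_restrictField`: for `K` CM, `θ` a character of `Γ_ℚ` unramified almost
everywhere, `θ_K` its base change and `S = {w : θ_K ramified at w}`, `S.image (c • ·) = S` (the
conjugate modulus of de Shalit's functional equation is again the exact ramification set).
[cite: deShalit1987, II.6.1 (1) (store chunk 81)]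
[cite: CasselsFrohlichANT1967, Ch. VII §4 Prop. 4.1 and §1.1] -/
theorem image_complexConj_eq_of_isHeckeCharOf [IsCMField K] (ι : PadicAlgCl p ≃+* ℂ)
    {S : Set (PadicAlgCl p)} {θ : FramedGaloisRep ℚ (padicCoeffIntegers S) 1}
    (hθ : ∀ᶠ u : HeightOneSpectrum (𝓞 ℚ) in cofinite, θ.IsUnramifiedAt u)
    {θK : HeckeCharacter K} (hθK : IsHeckeCharOf ι (θ.restrictField K) θK)
    {T : Finset (HeightOneSpectrum (𝓞 K))}
    (hT : ∀ w : HeightOneSpectrum (𝓞 K), w ∈ T ↔ ¬ θK.IsUnramifiedAt w) :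
    T.image (fun w ↦ IsCMField.complexConj K • w) = T :=
  image_complexConj_eq_of_galConj_eq (hθK.galConj_eq_of_restrictField ι hθ _) hT

/-- Likewise `isUnramifiedAt_reflect_inv_iff_of_galConj_eq` discharged: the reflected twist
`θ_K⁻¹‖·‖⁻¹ ∘ c = θ_K‖·‖` of the base change `θ_K` ramifies exactly where `θ_K` does.
[cite: deShalit1987, II.6.1 (1) (store chunk 81)]
[cite: CasselsFrohlichANT1967, Ch. VII §4 Prop. 4.1 and §1.1] -/
theorem isUnramifiedAt_reflect_inv_iff_of_isHeckeCharOf [IsCMField K] (ι : PadicAlgCl p ≃+* ℂ)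
    {S : Set (PadicAlgCl p)} {θ : FramedGaloisRep ℚ (padicCoeffIntegers S) 1}
    (hθ : ∀ᶠ u : HeightOneSpectrum (𝓞 ℚ) in cofinite, θ.IsUnramifiedAt u)
    {θK : HeckeCharacter K} (hθK : IsHeckeCharOf ι (θ.restrictField K) θK)
    (w : HeightOneSpectrum (𝓞 K)) :
    (DeShalit1987.reflect θK⁻¹).IsUnramifiedAt w ↔ θK.IsUnramifiedAt w :=
  isUnramifiedAt_reflect_inv_iff_of_galConj_eq (hθK.galConj_eq_of_restrictField ι hθ _) w

/-- **Uniqueness of the Hecke character attached to a `p`-adic character ("by Chebotarev such a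
`θ_K` is unique", the docstring of `IsHeckeCharOf`)**: if `θ' : Γ_K → 𝒪^×` is unramified at almost
all places, two Hecke characters `θ_K, θ_K'` with `IsHeckeCharOf ι θ' θ_K` and `IsHeckeCharOf ι θ' θ_K'`
are EQUAL — at every unramified `w` both take the value `ι(θ'(Frob_w))` at a uniformiser (the
Frobenius value is well defined, Serre 1968 Ch. I §2.1), and a Hecke character is determined by its
values at almost all uniformisers (Cassels–Fröhlich VII §4 Prop. 4.1,
`HeckeCharacter.ext_of_eventually_valueAtUniformizer_eq`).  (Use: transport `IsFiniteOrder` from the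
finite-order witness of arithmetic reciprocity to ANY `θ_K` with `IsHeckeCharOf`.)
[cite: CasselsFrohlichANT1967, Ch. VII §4 Prop. 4.1] [cite: SerreAbelianLadic1968, Ch. I §2.1] -/
theorem _root_.Literature.NumberTheory.EllipticCurves.KellerYin2024.IsHeckeCharOf.unique
    (ι : PadicAlgCl p ≃+* ℂ) {S : Set (PadicAlgCl p)}
    {θ' : FramedGaloisRep K (padicCoeffIntegers S) 1}
    (hθ' : ∀ᶠ w : HeightOneSpectrum (𝓞 K) in cofinite, θ'.IsUnramifiedAt w)
    {θK θK' : HeckeCharacter K} (h₁ : IsHeckeCharOf ι θ' θK) (h₂ : IsHeckeCharOf ι θ' θK') :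
    θK = θK' := by
  apply HeckeCharacter.ext_of_eventually_valueAtUniformizer_eq
  filter_upwards [hθ'] with w hw
  obtain ⟨𝔓, h𝔓⟩ := w.primesAbove_nonempty
  obtain ⟨φ, hφ⟩ := HeightOneSpectrum.exists_isArithFrobAt_of_mem_primesAbove_holds h𝔓
  have ha : θ'.HasFrobCharpolyAt w (Polynomial.X - Polynomial.C
      (((θ' φ : GL (Fin 1) (padicCoeffIntegers S)) :
        Matrix (Fin 1) (Fin 1) (padicCoeffIntegers S)) 0 0)) := by
    have h := hasFrobCharpolyAt_charpoly_of_isUnramifiedAt hw h𝔓 hφ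
    rwa [FramedGaloisRep.charpoly_eq_of_rank_one] at h
  rw [(h₁ w hw).2 _ ha, (h₂ w hw).2 _ ha]

/-- **The restriction to `Γ_K` of a character of `Γ_ℚ` unramified almost everywhere is unramified
almost everywhere** (the places of `K` above the finitely many ramified rational primes are finitely
many; `FramedGaloisRep.isUnramifiedAt_restrictField`).  Serre 1968, Ch. I §2.1.
[cite: SerreAbelianLadic1968, Ch. I §2.1] -/
theorem eventually_isUnramifiedAt_restrictField_rat {A : Type*} [CommRing A] [TopologicalSpace A]
    {n : ℕ} (θ : FramedGaloisRep ℚ A n)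
    (hθ : ∀ᶠ u : HeightOneSpectrum (𝓞 ℚ) in cofinite, θ.IsUnramifiedAt u) :
    ∀ᶠ w : HeightOneSpectrum (𝓞 K) in cofinite, (θ.restrictField K).IsUnramifiedAt w := by
  filter_upwards [eventually_under_of_eventually (K := K) hθ] with w hw
  exact θ.isUnramifiedAt_restrictField (HeightOneSpectrum.under_asIdeal (𝓞 ℚ) w).symm hw

/-- Uniqueness for the base change from `ℚ`: two Hecke characters of `K` attached by `IsHeckeCharOf`
to the restriction of one character `θ` of `Γ_ℚ` unramified almost everywhere coincide (so the
finite-order witness produced by arithmetic reciprocity IS any given `θ_K`).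
[cite: CasselsFrohlichANT1967, Ch. VII §4 Prop. 4.1] [cite: SerreAbelianLadic1968, Ch. I §2.1] -/
theorem _root_.Literature.NumberTheory.EllipticCurves.KellerYin2024.IsHeckeCharOf.unique_of_restrictField
    (ι : PadicAlgCl p ≃+* ℂ) {S : Set (PadicAlgCl p)}
    {θ : FramedGaloisRep ℚ (padicCoeffIntegers S) 1}
    (hθ : ∀ᶠ u : HeightOneSpectrum (𝓞 ℚ) in cofinite, θ.IsUnramifiedAt u)
    {θK θK' : HeckeCharacter K} (h₁ : IsHeckeCharOf ι (θ.restrictField K) θK)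
    (h₂ : IsHeckeCharOf ι (θ.restrictField K) θK') : θK = θK' :=
  h₁.unique ι (eventually_isUnramifiedAt_restrictField_rat θ hθ) h₂

end BaseChange

end Literature.NumberTheory.EllipticCurves.Hida2010MuInvariant

end
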